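import Literature.IUT.LogThetaLattice.GlobalFrobenioidModels
import Literature.NumberTheory.Automorphic.GaloisActionPlaces
import Mathlib.NumberTheory.NumberField.InfinitePlace.Ramification
import Mathlib.RingTheory.DedekindDomain.SelmerGroup
import Mathlib.Analysis.SpecialFunctions.Log.Basic
import Mathlib.Algebra.Order.Monoid.Submonoid

/-!
# [IUTchIII] Remark 3.6.1 at the model: the subquotient data of `F^×_mod` at the places of a number field

Discharge-at-the-model file (abc-iut cell, wave-3 discharge seat abc-iut-L6-d1; node **IUTchIII:Rmk3.6.1**)
for abc-iut-L6-t6's `Literature/IUT/LogThetaLattice/GlobalFrobenioidModels.lean`. There, [IUTchIII]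
Remark 3.6.1 (kurims p. 108) — "the various homomorphisms `β_v`, for `v ∈ 𝕍`, may be thought of,
alternatively, as a collection of subquotients of the perfection `(F^×_mod)^{pf}` of `F^×_mod` — each of which
is equipped with a submonoid of 'nonnegative elements' — that are completely determined by the ring
structure of the field `F_mod`" — is typed over ABSTRACT data `(V, Γ_v, Γ_v^{≥0}, β_v)` as the predicate
`Remark361_determined`: every ring automorphism `σ` of `F_mod` carries the "nonnegative" part
`β_v⁻¹(Γ_v^{≥0}) ⊆ F^×_mod` of the datum at `v` onto that of some `v'`. Over abstract data this is a
hypothesis. HERE it is PROVED at the intended model: `F` a number field, `V` = the set of ALL places of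
`F` (finite places `HeightOneSpectrum (𝓞 F)` ⊔ archimedean places `InfinitePlace F`, [IUTchI] Def. 3.1
(e) `𝕍 ≅ 𝕍_mod`), `Γ_v = ℝ ⊇ Γ_v^{≥0} = ℝ_{≥0}`, `β_v = ord_v` (finite `v`; so `β_v ≥ 0` iff `v`-integral)
resp. `β_v = −log |·|_v` (archimedean `v`; `β_v ≥ 0` iff `|·|_v ≤ 1`), and `σ` acts on places by transport
(`v' = σ·v`, via the tree's Galois action on finite places `Literature.NumberTheory.Automorphic` —
Cassels–Fröhlich VII §1.1 `|a|_{σw} = |σ⁻¹a|_w` — and `InfinitePlace.comap σ⁻¹`).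

S. Mochizuki, *Inter-universal Teichmüller theory III*, kurims manuscript (May 2020), Remark 3.6.1 p. 108;
Example 3.6 p. 107 (`β_v`). Claim key `Mochizuki2012`, status DISPUTED (D-0012): what is proved is classical
algebraic number theory (conjugate places), taking no side on [IUTchIII] Cor. 3.12 (typed ≠ discharged:
this discharges the MODEL instance of one remark-level predicate, nothing more).
-/

noncomputable section

namespace Literature.IUT.LogThetaLattice

namespace GlobalFrobenioidModels

open NumberField IsDedekindDomain
open Literature.NumberTheory.Automorphic

universe u

variable (F : Type u) [Field F] [NumberField F]

/-- The MODEL index set `𝕍 ≅ 𝕍_mod` of [IUTchIII] Example 3.6 / Remark 3.6.1 (p. 107–108): all places of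
the number field `F_mod` — finite places (nonzero primes of `𝓞 F`) and archimedean places.
[claim: Mochizuki2012, status: disputed] -/
abbrev ModelPlaces : Type u := HeightOneSpectrum (𝓞 F) ⊕ InfinitePlace F

variable {F}

/-- `β_v = ord_v : F^× → ℤ ⊆ ℝ` at a finite place `v` ([IUTchIII] Ex. 3.6 p. 107, the valuation of
`F_mod` at `v`), normalised so that `β_v(f) ≥ 0` iff `f` is `v`-integral. [claim: Mochizuki2012, status: disputed] -/
def betaFin (w : HeightOneSpectrum (𝓞 F)) : Additive Fˣ →+ ℝ :=
  -((Int.castAddHom ℝ).comp (MonoidHom.toAdditiveLeft (w.valuationOfNeZero (K := F))))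

/-- `β_v = −log |·|_v : F^× → ℝ` at an archimedean place `v` ([IUTchIII] Ex. 3.6 p. 107; archimedean
"integers" = elements of absolute value `≤ 1`). [claim: Mochizuki2012, status: disputed] -/
def betaInf (v : InfinitePlace F) : Additive Fˣ →+ ℝ where
  toFun f := -Real.log (v ((Additive.toMul f : Fˣ) : F))
  map_zero' := by simp
  map_add' f g := by
    rw [toMul_add, Units.val_mul, map_mul, Real.log_mul (v.pos_iff.mpr (Units.ne_zero _)).ne'
      (v.pos_iff.mpr (Units.ne_zero _)).ne', neg_add]

/-- The MODEL homomorphisms `β_v`, `v ∈ 𝕍`, of [IUTchIII] Example 3.6 (p. 107), valued in `Γ_v = ℝ`.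
[claim: Mochizuki2012, status: disputed] -/
def betaModel : ModelPlaces F → (Additive Fˣ →+ ℝ) := Sum.elim betaFin betaInf

/-- The MODEL submonoids of "nonnegative elements" `Γ_v^{≥0} = ℝ_{≥0} ⊆ Γ_v = ℝ`.
[claim: Mochizuki2012, status: disputed] -/
def nonnegModel : ModelPlaces F → AddSubmonoid ℝ := fun _ => AddSubmonoid.nonneg ℝ

/-- At a finite place, `f` lies in the "nonnegative" part `β_v⁻¹(ℝ_{≥0})` of the Remark 3.6.1 datum iff
`f` is `v`-integral (`v(f) ≤ 1` for the `v`-adic valuation). [claim: Mochizuki2012, status: disputed] -/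
theorem mem_datum_inl_iff (w : HeightOneSpectrum (𝓞 F)) (f : Fˣ) :
    Additive.ofMul f ∈ (Remark361_subquotientDatum (nonneg := nonnegModel) (β := betaModel)
        (Sum.inl w : ModelPlaces F)).2 ↔ w.valuation F (f : F) ≤ 1 := by
  change Additive.ofMul f ∈ (AddSubmonoid.nonneg ℝ).comap (betaFin w) ↔ _
  rw [AddSubmonoid.mem_comap, AddSubmonoid.mem_nonneg, betaFin, AddMonoidHom.neg_apply, neg_nonneg,
    AddMonoidHom.coe_comp, Function.comp_apply, MonoidHom.coe_toAdditiveLeft, Function.comp_apply,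
    Function.comp_apply, toMul_ofMul, ← HeightOneSpectrum.valuationOfNeZero_eq, ← WithZero.coe_one,
    WithZero.coe_le_coe, ← Multiplicative.toAdd_le, toAdd_one, Int.coe_castAddHom]
  exact Int.cast_nonpos

/-- At an archimedean place, `f` lies in the "nonnegative" part of the datum iff `|f|_v ≤ 1`.
[claim: Mochizuki2012, status: disputed] -/
theorem mem_datum_inr_iff (v : InfinitePlace F) (f : Fˣ) :
    Additive.ofMul f ∈ (Remark361_subquotientDatum (nonneg := nonnegModel) (β := betaModel)
        (Sum.inr v : ModelPlaces F)).2 ↔ v (f : F) ≤ 1 := by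
  change Additive.ofMul f ∈ (AddSubmonoid.nonneg ℝ).comap (betaInf v) ↔ _
  rw [AddSubmonoid.mem_comap, AddSubmonoid.mem_nonneg]
  change 0 ≤ -Real.log (v (f : F)) ↔ _
  rw [neg_nonneg, Real.log_nonpos_iff (apply_nonneg v _)]

variable (F) in
/-- **IUTchIII:Rmk3.6.1** (kurims p. 108) "… completely determined by the ring structure of the field `F_mod`"
— the typed predicate `Remark361_determined` HOLDS at the model (all places of a number field, `β_v` the
valuations / `−log` of the archimedean absolute values): a ring automorphism `σ` of `F_mod` carries the
nonnegative part of the datum at `v` onto that at the transported place `σ·v` (finite `v`: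
`ord_{σw}(σ f) = ord_w(f)`, Cassels–Fröhlich VII §1.1, the tree's `HeightOneSpectrum.valuation_smul`;
archimedean `v`: `|σ f|_{v∘σ⁻¹} = |f|_v`). DISCHARGED at the model. [claim: Mochizuki2012, status: disputed] -/
theorem remark361_determined_model :
    Remark361_determined (nonneg := (nonnegModel : ModelPlaces F → _)) (β := betaModel) := by
  intro σ v
  rcases v with w | v
  · refine ⟨Sum.inl ((σ : RingAut F) • w), fun f => ?_⟩
    rw [mem_datum_inl_iff, mem_datum_inl_iff]
    change _ ↔ ((σ : RingAut F) • w).valuation F (σ (f : F)) ≤ 1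
    rw [← RingAut.smul_def σ (f : F), HeightOneSpectrum.valuation_smul]
  · refine ⟨Sum.inr (v.comap σ.symm.toRingHom), fun f => ?_⟩
    rw [mem_datum_inr_iff, mem_datum_inr_iff]
    change _ ↔ (v.comap σ.symm.toRingHom) (σ (f : F)) ≤ 1
    rw [InfinitePlace.comap_apply, RingEquiv.toRingHom_eq_coe, RingHom.coe_coe, RingEquiv.symm_apply_apply]

end GlobalFrobenioidModels

end Literature.IUT.LogThetaLattice
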